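import Summits.ResolutionOfSingularities.ResolutionOfSingularities.Theorems.WeightedInvariantRatContactCorrections
import Summits.ResolutionOfSingularities.ResolutionOfSingularities.Theorems.WeightedInvariantJFlatEssSmoothDescent
import HarnessLib

/-!
# ONE-MEMBER (σ-RATIO) DESCENT: a rational one-flag contact weight reached upstairs is reached downstairs, along a local
# formally smooth e.f.t. homomorphism of three-dimensional regular local rings with `𝔪S' = 𝔪'` (door `HypersurfaceCentreConstruction`,
# stmt-ResolutionOfSingularities-19897; P3 rung; (o53-desc′) PART 1, brick 2c = the induction; hand res-L1-w43-stub-3)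

Topic: `Summits/ResolutionOfSingularities/ResolutionOfSingularities/Theorems`. Helper for the door item
`HypersurfaceCentreConstruction` (stmt-ResolutionOfSingularities-19897, route `WeightedInvariant`), line `local-engine` (L W4.3),
def-free.

**What is proved.** `φ : S → S'` local, formally smooth, essentially of finite type between regular local rings of dimension
three with `𝔪_S S' = 𝔪_{S'}`, `f ∈ 𝔪_S ∖ 0`, `ν = ord f`, `0 < b`:
`Iota3.RatContact.OneFlagReaches (φ f) ν a b → OneFlagReaches f ν a b` (`oneFlagReaches_of_algebraMap`) and the `iff`
(`oneFlagReaches_algebraMap_iff`).  In words: if SOME regular parameter `g'` of `S'` carries `φ f` to the rational contact weight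
`a/b` (`φ f ∈ ⨆_α (g'^α) 𝔪'^⌈(aν − aα)/b⌉`), then some regular parameter of `S` carries `f` to the same weight.  The top member of a
contact flag is pinned by `in_ν(f)` — no maximality is needed; contrast the TWO-member statement, which is FALSE for non-maximal
flags (memo O53-DESC-CEX of this hand: `f = w³ + Q(u,v)²`, `Q` anisotropic over `κ`, isotropic over a separable quadratic `κ'`).

**Proof** (`exists_correction_dim3_of_ratContact` + induction on the numerator `a`, `b` fixed).  Slopes `a/b ≤ 1` are reached by
every parameter.  Step `a → a+1` (`a ≥ b`): `g'` reaches `(a+1)/b`, hence `a/b`; by induction a rational `y` reaches `a/b`, so does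
`φ y`.  If `b ∤ a`: C2 at rational slope (p563278) gives `g' ≡ u φy (mod 𝔪'^⌈a/b⌉)` and `⌈a/b⌉ = ⌈(a+1)/b⌉`.  If `b ∣ a`, `c = a/b`:
GAP 1″ in rational-slope form (brick 2b: tangent step at `c = 1` with the three-triples trick of p555186, face step at `c ≥ 2`)
gives `g' ≡ u φ(y + r) (mod 𝔪'^{c+1})`, and `c + 1 = ⌈(a+1)/b⌉`.  Either way the congruence modulo `𝔪'^⌈(a+1)/b⌉` identifies the two
rational filtrations (`ratContactFiltration_eq_of_sub_unit_mul_mem_pow`) and faithful flatness reflects the membership to `S`.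

**Consequence for the σ-letters** (res-L1-w43-idea-2's one-flag collapse, p560066 `FlagReaches.oneFlagReaches` /
`flagReaches_of_mem_ratContactFiltration`): the RATIO letter `σ₁` (the largest contact weight `r₁/r₂` of a two-flag = the largest
one-flag rational weight) takes the same values on `S` and `S'` — the provable half of (c11σ); the LEVEL letter is where genuine
two-flags and σ-maximality enter ((o70-b)).

[OURS · L1 W4.3 · (o53-desc′) PART 1]  Replaces the role of NO printed item; NOT a statement of the manuscript
[claim: Hironaka2017, status: under-review]. AI work, weaker than expert review.  Named facts used (through p548127 only):
`Literature.FormallySmoothField.{formallySmooth_iff_separable (F2), essFiniteType_iff_fg (F3), exists_pthRoot_of_adjoin_pow_eq_top (F4)}`.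

## References

* H. Hironaka, *Characteristic polyhedra of singularities*, J. Math. Kyoto Univ. 7 (1967), §3, Thm. (4.8). [Hironaka1967]
* V. Cossart, U. Jannsen, S. Saito, *Desingularization*, LNM 2270 (2020), Lemma 8.3. [CossartJannsenSaito2020]
* A. Grothendieck, *EGA IV*, Publ. Math. IHÉS 20 (1964), 0_IV (19.6.1), (19.7.1), (17.5.1). [EGA0IV]
-/

noncomputable section

open IsLocalRing Literature.AlgebraicGeometry.Resolution
open Summit.ResolutionOfSingularities.ResolutionOfSingularities.Cruxes.HypersurfaceCentreConstruction.LocalEngine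
open Summit.ResolutionOfSingularities.ResolutionOfSingularities.Cruxes.HypersurfaceCentreConstruction.LocalEngine.Iota3.RatContact

set_option linter.dupNamespace false -- mandated namespace of this single-conjunct summit

namespace Summit.ResolutionOfSingularities.ResolutionOfSingularities.Theorems

namespace JFlatEssSmooth

open IotaOrderEssSmooth (mem_maximalIdeal_pow_iff_of_formallySmooth)

section Descent

variable {S S' : Type} [CommRing S] [CommRing S'] [IsRegularLocalRing S] [IsRegularLocalRing S'] [Algebra S S']
  [IsLocalHom (algebraMap S S')] [Algebra.FormallySmooth S S'] [Algebra.EssFiniteType S S']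

/-- **The rational correction in dimension three, rational-slope form** (`exists_correction_dim3` of p555186 with the
hypothesis on `g'` weakened to «reaches some rational weight `a'/b' > b`»).  [cite: Hironaka1967, §3, Thm. (4.8)]
[OURS · L1 W4.3 · (o53-desc′) PART 1] -/
theorem exists_correction_dim3_of_ratContact (h𝔪 : (maximalIdeal S).map (algebraMap S S') = maximalIdeal S')
    (hdim : ringKrullDim S = (3 : ℕ)) (hdim' : ringKrullDim S' = (3 : ℕ)) {f : S} (hf0 : f ≠ 0)
    (hf : f ∈ maximalIdeal S) :
    ∀ b : ℕ, 1 ≤ b → ∀ y : S, y ∈ maximalIdeal S → y ∉ maximalIdeal S ^ 2 →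
      f ∈ contactFiltration y b (b * (adicOrder f).toNat) → ∀ g' : S', g' ∈ maximalIdeal S' → g' ∉ maximalIdeal S' ^ 2 →
      ∀ a' b' : ℕ, 0 < b' → b * b' < a' →
      algebraMap S S' f ∈ ratContactFiltration g' a' b' (a' * (adicOrder f).toNat) →
      ∃ (r : S) (u : S'), r ∈ maximalIdeal S ∧ y + r ∉ maximalIdeal S ^ 2 ∧ IsUnit u ∧
        g' - u * algebraMap S S' (y + r) ∈ maximalIdeal S' ^ (b + 1) := by
  intro b hb y hy hy2 hfy g' hg' hg'2 a' b' hb' hslope hfg'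
  obtain ⟨hν, hfν, hford⟩ := EssSmoothLevels.adicOrder_toNat_spec hf0 hf
  have hd3 : (maximalIdeal S).spanFinrank = 3 := by
    have h := IsRegularLocalRing.spanFinrank_maximalIdeal (R := S)
    rw [hdim] at h
    exact_mod_cast h
  have hd3' : (maximalIdeal S').spanFinrank = 3 := by
    have h := IsRegularLocalRing.spanFinrank_maximalIdeal (R := S')
    rw [hdim'] at h
    exact_mod_cast h
  have hdim'3 : ringKrullDim S' = 3 := by rw [hdim', Nat.cast_ofNat]
  -- a regular system `z` of `S` through `y = z 0`
  obtain ⟨z, hz, hz0⟩ := exists_rsop_apply_eq hd3 hy hy2 (0 : Fin 3)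
  subst hz0
  have hgen : Ideal.span {z 0, z 1, z 2} = maximalIdeal S := by rw [← range_fin_three]; exact hz
  rcases Nat.lt_or_ge b 2 with hb1 | hb2
  · obtain rfl : b = 1 := by omega
    have hslope1 : b' < a' := by simpa using hslope
    have hz' : Ideal.span (Set.range (algebraMap S S' ∘ z)) = maximalIdeal S' := by
      rw [Set.range_comp, ← Ideal.map_span, hz, h𝔪]
    rcases not_mem_span_pair_sup_sq_of_three hd3' (algebraMap S S' ∘ z) hz' hg'2 with hl | hl | hl
    · exact exists_correction_one_of_ratContact h𝔪 hdim'3 z hgen hν hford hfν hg' hl hb' hslope1 hfg'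
    · have hgen₁ : Ideal.span {(![z 0, z 1 + z 0, z 2] : Fin 3 → S) 0, (![z 0, z 1 + z 0, z 2] : Fin 3 → S) 1,
          (![z 0, z 1 + z 0, z 2] : Fin 3 → S) 2} = maximalIdeal S := by
        simp only [Matrix.cons_val_zero, Matrix.cons_val_one, Matrix.cons_val_two, Matrix.head_cons, Matrix.tail_cons]
        rw [span_triple_add_left_eq]; exact hgen
      have hl₁ : g' ∉ Ideal.span {algebraMap S S' ((![z 0, z 1 + z 0, z 2] : Fin 3 → S) 1),
          algebraMap S S' ((![z 0, z 1 + z 0, z 2] : Fin 3 → S) 2)} ⊔ maximalIdeal S' ^ 2 := by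
        simpa [map_add] using hl
      exact exists_correction_one_of_ratContact h𝔪 hdim'3 _ hgen₁ hν hford hfν hg' hl₁ hb' hslope1 hfg'
    · have hgen₂ : Ideal.span {(![z 0, z 1, z 2 + z 0] : Fin 3 → S) 0, (![z 0, z 1, z 2 + z 0] : Fin 3 → S) 1,
          (![z 0, z 1, z 2 + z 0] : Fin 3 → S) 2} = maximalIdeal S := by
        simp only [Matrix.cons_val_zero, Matrix.cons_val_one, Matrix.cons_val_two, Matrix.head_cons, Matrix.tail_cons]
        rw [span_triple_add_right_eq]; exact hgen
      have hl₂ : g' ∉ Ideal.span {algebraMap S S' ((![z 0, z 1, z 2 + z 0] : Fin 3 → S) 1),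
          algebraMap S S' ((![z 0, z 1, z 2 + z 0] : Fin 3 → S) 2)} ⊔ maximalIdeal S' ^ 2 := by
        simpa [map_add] using hl
      exact exists_correction_one_of_ratContact h𝔪 hdim'3 _ hgen₂ hν hford hfν hg' hl₂ hb' hslope1 hfg'
  · exact exists_correction_of_two_le_of_ratContact h𝔪 hdim'3 z hgen hy2 hν hb2 hford hfy hg' hg'2 hb' hslope hfg'

/-- The common ending of every induction step: a parameter `y` of `S` with `g' ≡ u φ y (mod 𝔪'^⌈a/b⌉)`, `u` a unit, turns
`φ f ∈ RC_{g'}(a,b)(aν)` into `OneFlagReaches f ν a b` (equal filtrations + faithful flatness). [folklore] -/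
theorem oneFlagReaches_of_congr (h𝔪 : (maximalIdeal S).map (algebraMap S S') = maximalIdeal S') {f : S} {ν a b : ℕ}
    (hb : 0 < b) {g' : S'} {y : S} (hy : y ∈ maximalIdeal S) (hy2 : y ∉ maximalIdeal S ^ 2) {u : S'} (hu : IsUnit u)
    (hcong : g' - u * algebraMap S S' y ∈ maximalIdeal S' ^ ((a + b - 1) / b))
    (hfg' : algebraMap S S' f ∈ ratContactFiltration g' a b (a * ν)) : OneFlagReaches f ν a b := by
  refine ⟨y, hy, hy2, ?_⟩
  rw [RatContactEssSmooth.ratContactFiltration_eq_of_sub_unit_mul_mem_pow hu hb hcong (a * ν)] at hfg'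
  exact (RatContactEssSmooth.algebraMap_mem_ratContactFiltration_iff h𝔪 f y a b _).mp hfg'

/-- **ONE-MEMBER (σ-RATIO) DESCENT.**  `φ : S → S'` local, formally smooth, essentially of finite type between regular local rings of
dimension three with `𝔪_S S' = 𝔪_{S'}`; `f ∈ 𝔪_S ∖ 0`, `ν = ord f`, `0 < b`.  If a regular parameter of `S'` carries `φ f` to the
rational contact weight `a/b`, then a regular parameter of `S` carries `f` to the same weight:
`OneFlagReaches (φ f) ν a b → OneFlagReaches f ν a b`. [cite: Hironaka1967, §3, Thm. (4.8)] [OURS · L1 W4.3 · (o53-desc′) PART 1] -/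
theorem oneFlagReaches_of_algebraMap (h𝔪 : (maximalIdeal S).map (algebraMap S S') = maximalIdeal S')
    (hdim : ringKrullDim S = (3 : ℕ)) (hdim' : ringKrullDim S' = (3 : ℕ)) {f : S} (hf0 : f ≠ 0) (hf : f ∈ maximalIdeal S)
    {b : ℕ} (hb : 0 < b) (a : ℕ) :
    OneFlagReaches (algebraMap S S' f) (adicOrder f).toNat a b → OneFlagReaches f (adicOrder f).toNat a b := by
  obtain ⟨hν, hfν, hford⟩ := EssSmoothLevels.adicOrder_toNat_spec hf0 hf
  set ν := (adicOrder f).toNat with hνdef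
  have hford' : algebraMap S S' f ∉ maximalIdeal S' ^ (ν + 1) := fun h =>
    hford ((mem_maximalIdeal_pow_iff_of_formallySmooth S S' _ f).mpr h)
  -- a regular parameter of `S` (dimension `3 ≠ 0`)
  obtain ⟨x, hx, hx2⟩ : ∃ x ∈ maximalIdeal S, x ∉ maximalIdeal S ^ 2 :=
    SetLike.exists_of_lt (IsLocalRing.maximalIdeal_sq_lt_of_ringKrullDim_ne_zero (by rw [hdim]; norm_num))
  induction a with
  | zero => exact fun _ => RatContactEssSmooth.oneFlagReaches_of_le hx hx2 (Nat.zero_le b) hb hfν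
  | succ a ih =>
    intro h
    by_cases hab : a + 1 ≤ b
    · exact RatContactEssSmooth.oneFlagReaches_of_le hx hx2 hab hb hfν
    have hba : b ≤ a := by omega
    obtain ⟨g', hg', hg'2, hfg'⟩ := h
    -- `g'` reaches `a/b` too; by induction a rational `y` reaches `a/b`
    have hfg'a : algebraMap S S' f ∈ ratContactFiltration g' a b (a * ν) :=
      RatContactEssSmooth.ratContactFiltration_anti g' (Nat.le_succ a) b ν hfg'
    obtain ⟨y, hy, hy2, hfy⟩ := ih ⟨g', hg', hg'2, hfg'a⟩
    have hφy : algebraMap S S' y ∈ maximalIdeal S' := h𝔪 ▸ Ideal.mem_map_of_mem _ hy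
    have hφy2 : algebraMap S S' y ∉ maximalIdeal S' ^ 2 := fun h2 =>
      hy2 ((mem_maximalIdeal_pow_iff_of_formallySmooth S S' 2 y).mpr h2)
    have hfy' : algebraMap S S' f ∈ ratContactFiltration (algebraMap S S' y) a b (a * ν) :=
      (RatContactEssSmooth.algebraMap_mem_ratContactFiltration_iff h𝔪 f y a b _).mpr hfy
    by_cases hd : b ∣ a
    · -- integer slope `c = a/b ≥ 1`: GAP 1″ in rational-slope form at level `c`
      obtain ⟨c, rfl⟩ := hd
      have hc1 : 1 ≤ c := by
        rcases Nat.eq_zero_or_pos c with rfl | hc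
        · omega
        · exact hc
      have hceil : (b * c + 1 + b - 1) / b = c + 1 := by
        rw [(RatContactEssSmooth.ceilDiv_succ_of_dvd hb ⟨c, rfl⟩).1, Nat.mul_div_cancel_left c hb]
      have hfyc : f ∈ contactFiltration y c (c * ν) := by
        rw [← RatContactEssSmooth.ratContactFiltration_mul_eq_contactFiltration y c hb ν, Nat.mul_comm c b]; exact hfy
      have hslope : c * b < b * c + 1 := by rw [Nat.mul_comm]; exact Nat.lt_succ_self _
      obtain ⟨r, u, hr, hyr2, hu, hcong⟩ := exists_correction_dim3_of_ratContact h𝔪 hdim hdim' hf0 hf c hc1 y hy hy2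
        hfyc g' hg' hg'2 (b * c + 1) b hb hslope hfg'
      refine oneFlagReaches_of_congr h𝔪 hb (Ideal.add_mem _ hy hr) hyr2 hu ?_ hfg'
      rw [hceil]; exact hcong
    · -- `b ∤ a`: C2 at the rational slope `a/b > 1` already gives the congruence modulo `𝔪'^⌈(a+1)/b⌉`
      have hba' : b < a := lt_of_le_of_ne hba (fun h => hd (h ▸ dvd_refl b))
      obtain ⟨u, hu⟩ := RatContactCanonical.exists_unit_sub_mul_mem_pow_of_mem_ratContactFiltration hg' hg'2 hφy hφy2 hb
        hba' hν hford' hfg'a hfy'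
      refine oneFlagReaches_of_congr h𝔪 hb hy hy2 u.isUnit ?_ hfg'
      rw [RatContactEssSmooth.ceilDiv_succ_of_not_dvd hb hd]; exact hu

/-- **One-member reach is the same upstairs and downstairs** (`iff` form: ascent is `oneFlagReaches_algebraMap`).
[cite: Hironaka1967, §3, Thm. (4.8)] [cite: EGA0IV, 0_IV (19.7.1)] [OURS · L1 W4.3 · (o53-desc′) PART 1] -/
theorem oneFlagReaches_algebraMap_iff (h𝔪 : (maximalIdeal S).map (algebraMap S S') = maximalIdeal S')
    (hdim : ringKrullDim S = (3 : ℕ)) (hdim' : ringKrullDim S' = (3 : ℕ)) {f : S} (hf0 : f ≠ 0) (hf : f ∈ maximalIdeal S)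
    {b : ℕ} (hb : 0 < b) (a : ℕ) :
    OneFlagReaches (algebraMap S S' f) (adicOrder f).toNat a b ↔ OneFlagReaches f (adicOrder f).toNat a b :=
  ⟨oneFlagReaches_of_algebraMap h𝔪 hdim hdim' hf0 hf hb a, RatContactEssSmooth.oneFlagReaches_algebraMap h𝔪⟩

end Descent

end JFlatEssSmooth

end Summit.ResolutionOfSingularities.ResolutionOfSingularities.Theorems

end
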